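import Summits.QuantumFields.QCD.Theses.WilsonQuarkChessboard

/-!
# Birth skeleton (BC3) for crux `WilsonQuarkChessboard.ChiralDescent`
# (item stmt-QuantumFields-17578, route route-QuantumFields-WilsonQuarkChessboard, rank 7; tree path
# `Cruxes/ChiralDescent/Lines/birth.lean` — NB the directory `Cruxes/ChiralDescent/` is SHARED with the sibling crux
# stmt-QuantumFields-17527 `SpectralDefectExtinction.ChiralDescent`, whose lead line is `Lines/Sketch.lean`)

THE CRUX (verbatim the route decl): `(∀ N_f ∈ {2,3}, ∃ M₀ ≥ 0, ∃ reg mass-scaling, body above M₀) → QCD`, where the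
per-tuple BODY is the full body of the re-typed conjunct `QCDOf` (OS data with `IsQCDAlong`, non-trivial non-Gaussian
glue, non-decoupled flavour-changing pseudoscalars, one rate `Δ > 0` for `T.HasMassGap` and `HasLatticeMassGap`) and
`QCD = QCDOf 2 ∧ QCDOf 3`.  It is implied, by three lines of logic (the first `example` of §3 below), by the sibling
crux `SpectralDefectExtinction.ChiralDescent = ∀ N_f ∈ {2,3}, Threshold N_f → QCDOf N_f` (stmt-17527): the two items are
the same mathematics (pin the flavour-blind additive offset of `m_crit` at the chiral point, `reg.IsChiralAtZero`), filed
by two routes with the `∀ N_f` in different places.  This skeleton therefore REGISTERS FOR 17578 THE INFIMUM-DESCENT LINE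
already reduced, kernel-checked, for 17527 (landed glue `Theorems/SpectralDefectExtinctionChiralDescentInfimumDescent`,
p134498; equivalences `…ChiralPointEquivalence`, p137636), so that stub work is shared and either crux closing closes the
other.  IMPORT CLOSURE = THE ROUTE FILE ONLY: the ~90 lines of landed glue this composition needs (infimum descent,
shifted witness; originals p134498 and `RobustYangMillsHandover/Negative/ChiralityObstruction`) are RE-PROVED locally in
`namespace … Birth.Glue` (§2) instead of imported, because those modules sit on two OTHER route files
(`Theses.SpectralDefectExtinction`, `Theses.HeatSlicedQuarks`) that the gate rewrites at every edit of those routes — at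
registration time the farm reported exactly that closure stale/incoherent (rc 75).  Same statements, same proofs.

THE LINE.  For the hypothesis' regularisation `reg` let `S := {μ : ℝ | every tuple above μ carries the body}` (an
up-set containing `M₀`).  The `m_crit`-shift of `reg` by `μ` witnesses `QCDOf N_f` iff `μ ∈ S` and `reg` has NO uniform
lattice rate just above `μ` (`qcdOf_of_bodyAbove_of_noUniformGapAbove`).  The infimum descent
(`exists_threshold_not_gapProp`: either `S = ℝ`, or `inf S ∈ S` is attained — `0 < N_f` — and openness would push
`inf S − δ` into `S`) reduces the crux to TWO physics statements about `reg`, the registered stubs: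

* `stub_lightQuarkContinuation` (OPENNESS of `S` at uniformly gapped offsets; conjecture class, size L–XL): if the body
  holds at every tuple above `μ` AND one lattice rate `ε > 0` holds at every tuple above `μ`, then the body holds above
  `μ − δ` for some `δ > 0`.  Physics: a uniformly gapped massive lattice QCD family is stable under a small flavour-blind
  decrease of the renormalised quark mass — analytic continuation in the mass inside the gap (partition polynomial in the
  bare mass, Lee–Yang-type zero-free region from the uniform rate, Vitali/Montel transport of the `IsQCDAlong` limits;
  the sibling line landed the bricks W1/W3a/W3b/W6 as `…ChiralDescentStub*.lean`), i.e. the light-quark CONTINUATION of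
  the massive construction down to the first offset where the uniform rate fails.  Load-bearing and hardest.
* `stub_chiralPointOfBodyEverywhere` (FINITE CHIRAL POINT, the `S = ℝ` branch; conjecture class, a no-go in disguise):
  a mass-scaling regularisation carrying the body at EVERY real tuple has, above some offset, no uniform lattice rate.
  Physically its hypothesis is never met (an all-offsets massive non-decoupled family must cross its chiral / Dashen
  point, where `HasLatticeMassGap` fails for every rate: `m_π² f_π² = (m_u + m_d) Σ`, Goldstone given χSB, 't Hooft
  anomaly matching otherwise), but nothing in the tree bounds a lattice-QCD correlator from below, so the branch cannot
  be discharged now.  Verbatim the sibling's registered H2 (cycle 3) / hypothesis `h2` of the landed glue.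

COMPOSITION: `qcd_of_lightQuarkContinuation_of_chiralPoint : stub₁-sig → stub₂-sig → (crux unfolded: thresholds → QCD)`
(sorry-free, std axioms) — per flavour number through `Glue.qcdOf_of_threshold_of_openness_of_finiteChiralPoint` (local
copy of the landed one), then `QCDOf 2 ∧ QCDOf 3`; and the registry form `ChiralDescent_of : ChiralDescent :=
qcd_of_… stub_lightQuarkContinuation stub_chiralPointOfBodyEverywhere` (conclusion literally the crux decl, stubs by name —
the form `ledger skeleton check` accepts; the hypotheses form with the folded conclusion is an `example`).
Also recorded as sorry-free kernel-checked `example`s (not named theorems, so that `ChiralDescent_of` is the only theorem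
concluding the crux): sibling crux (unfolded) ⇒ this crux, and this crux from the sibling's CURRENT single registered
stub E = `stub_chiralPointOfThreshold` (cycle 4) by the shifted witness — so whichever form a planner promotes (E, or the
sibling's H1/H2, or these two stubs) closes 17578 too.

DISPROOF USED (`Cruxes/ChiralDescent/Disproof.lean`, cdisprove cycle 1 FINAL, verdict RESISTS, no `-- Targets`; written
for the sibling decl, applies verbatim): §1 the crux fails only in the window `Threshold ∧ mass-uniform-gap` (barred by
`Literature.Barriers.QuantumFields.AnomalyMatching`) — both stubs sit in that window on the physics side, neither is a
data manipulation; §3 `not_isChiralAtZero_of_eventuallyThresholdData` (every regularisation NAMEABLE from threshold data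
inherits uniform gaps): honoured — the witness is the shift by `inf S`, which lies BELOW every uniformly gapped offset by
`stub_lightQuarkContinuation` itself; §2 `0 ≤ M₀` idle (discarded in `ChiralDescent_of`).  Landed negatives honoured:
`Theorems/ChiralDescent/Negative/FlavourGuard` (`not_qcdOf_zero`: the guard `N_f = 2 ∨ N_f = 3` is kept on both stubs and
supplies `0 < N_f` for the attained infimum; unguarded, `stub_chiralPointOfBodyEverywhere` would be false at `N_f = 0`
modulo pure-gauge existence), `Negative/DataLevelObstruction` (as §3), `RobustYangMillsHandover/Negative/ChiralityObstruction`
(`isChiralAtZero_mcrit_shift_iff`, used inside the landed shifted witness).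

BC3 PROBES (planner folder `bc/probe_*.lean`, this seat): for each stub, `stub → ChiralDescent` and `stub → QCD` by
`first | exact? | simpa | aesop` (and the BC2 variant with `simpa [ChiralDescent] | (unfold ChiralDescent; simpa)`) FAIL —
see NOTES.md `birth-certificate:` for rc and goals.
-/

namespace Summit.QuantumFields.QCD.Cruxes.ChiralDescent.Birth

open Filter Topology
open Literature.MathematicalPhysics.QuantumFieldTheory

/-! ## §1 The registered stubs -/

/-- **Stub 1 — LIGHT-QUARK CONTINUATION (openness of the body up-set at uniformly gapped offsets; conjecture class).**
For `N_f ∈ {2,3}` and a mass-scaling regularisation `reg`: if every tuple above `μ` carries the body of the re-typed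
conjunct and ONE lattice rate `ε > 0` holds at every tuple above `μ`, then for some `δ > 0` every tuple above `μ − δ`
carries the body.  Verbatim hypothesis `h1` of the landed `chiralDescent_of_openness_of_finiteChiralPoint` (p134498);
classically equivalent to "no uniform rate at the minimum of the body up-set" (`gaplessBodyInfimum_of_openness` /
`openness_of_gaplessBodyInfimum`, p137636). [folklore] -/
theorem stub_lightQuarkContinuation :
    ∀ Nf : ℕ, (Nf = 2 ∨ Nf = 3) → ∀ reg : QCDRegularisation Nf, reg.HasMassScaling → ∀ μ : ℝ,
      (∀ m : Fin Nf → ℝ, (∀ f, μ < m f) →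
        ∃ (z shift : QCDField Nf → ℕ → ℝ) (T : OSData (QCDField Nf) 4),
          IsQCDAlong (reg.scheme m z shift) T ∧ T.IsNontrivial QCDField.glue ∧ T.IsNonGaussian QCDField.glue ∧
            (∀ f g : Fin Nf, f ≠ g → T.IsNontrivial (QCDField.pseudoRe f g)) ∧
              ∃ Δ > 0, T.HasMassGap Δ ∧ (reg.scheme m z shift).HasLatticeMassGap Δ) →
      (∃ ε > (0 : ℝ), ∀ m : Fin Nf → ℝ, (∀ f, μ < m f) → (reg.scheme m 0 0).HasLatticeMassGap ε) →
      ∃ δ > (0 : ℝ), ∀ m : Fin Nf → ℝ, (∀ f, μ - δ < m f) →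
        ∃ (z shift : QCDField Nf → ℕ → ℝ) (T : OSData (QCDField Nf) 4),
          IsQCDAlong (reg.scheme m z shift) T ∧ T.IsNontrivial QCDField.glue ∧ T.IsNonGaussian QCDField.glue ∧
            (∀ f g : Fin Nf, f ≠ g → T.IsNontrivial (QCDField.pseudoRe f g)) ∧
              ∃ Δ > 0, T.HasMassGap Δ ∧ (reg.scheme m z shift).HasLatticeMassGap Δ := by
  sorry

/-- **Stub 2 — FINITE CHIRAL POINT (a body at every real tuple has a chiral offset; conjecture class, a no-go in
disguise).** For `N_f ∈ {2,3}` and a mass-scaling regularisation carrying the body at every real mass tuple, above some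
offset `μ` every rate `ε > 0` fails at some tuple.  Verbatim hypothesis `h2` of the landed glue (p134498) and the
sibling's registered H2. [folklore] -/
theorem stub_chiralPointOfBodyEverywhere :
    ∀ Nf : ℕ, (Nf = 2 ∨ Nf = 3) → ∀ reg : QCDRegularisation Nf, reg.HasMassScaling →
      (∀ m : Fin Nf → ℝ,
        ∃ (z shift : QCDField Nf → ℕ → ℝ) (T : OSData (QCDField Nf) 4),
          IsQCDAlong (reg.scheme m z shift) T ∧ T.IsNontrivial QCDField.glue ∧ T.IsNonGaussian QCDField.glue ∧
            (∀ f g : Fin Nf, f ≠ g → T.IsNontrivial (QCDField.pseudoRe f g)) ∧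
              ∃ Δ > 0, T.HasMassGap Δ ∧ (reg.scheme m z shift).HasLatticeMassGap Δ) →
      ∃ μ : ℝ, ∀ ε > (0 : ℝ), ∃ m : Fin Nf → ℝ, (∀ f, μ < m f) ∧ ¬ (reg.scheme m 0 0).HasLatticeMassGap ε := by
  sorry

/-! ## §2 Sorry-free glue (local copies of landed lemmas; originals cited in each docstring) -/

namespace Glue

variable {Nf : ℕ}

/-- `N_f ∈ {2,3}` gives `0 < N_f` (the flavour guard the attained infimum needs; `Negative/FlavourGuard`). [folklore] -/
theorem nf_pos (hNf : Nf = 2 ∨ Nf = 3) : 0 < Nf := by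
  rcases hNf with rfl | rfl <;> norm_num

/-- Every real tuple lies strictly above some flavour-blind offset (`−Σ_f |m_f| − 1`).
(Local copy of `InfimumDescent.neg_sum_abs_sub_one_lt`, p134498.) [folklore] -/
theorem neg_sum_abs_sub_one_lt (m : Fin Nf → ℝ) (f : Fin Nf) : -(∑ g, |m g|) - 1 < m f := by
  have h1 : -|m f| ≤ m f := neg_abs_le (m f)
  have h2 : |m f| ≤ ∑ g, |m g| :=
    Finset.single_le_sum (f := fun g => |m g|) (fun g _ => abs_nonneg (m g)) (Finset.mem_univ f)
  linarith

/-- **Attained infimum**: for `0 < N_f`, a non-empty bounded-below up-set `{μ | P above μ}` contains its infimum.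
(Local copy of `InfimumDescent.forall_above_csInf`, p134498.) [folklore] -/
theorem forall_above_csInf (hNf : 0 < Nf) (P : (Fin Nf → ℝ) → Prop)
    (hne : {μ : ℝ | ∀ m : Fin Nf → ℝ, (∀ f, μ < m f) → P m}.Nonempty)
    (hbdd : BddBelow {μ : ℝ | ∀ m : Fin Nf → ℝ, (∀ f, μ < m f) → P m}) :
    ∀ m : Fin Nf → ℝ, (∀ f, sInf {μ : ℝ | ∀ m : Fin Nf → ℝ, (∀ f, μ < m f) → P m} < m f) → P m := by
  classical
  intro m hm
  have hN : (Finset.univ : Finset (Fin Nf)).Nonempty := ⟨⟨0, hNf⟩, Finset.mem_univ _⟩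
  obtain ⟨f₀, -, hf₀⟩ := Finset.exists_min_image Finset.univ m hN
  obtain ⟨μ', hμ'S, hμ'lt⟩ := exists_lt_of_csInf_lt hne (hm f₀)
  have _ := hbdd
  exact hμ'S m fun f => lt_of_lt_of_le hμ'lt (hf₀ f (Finset.mem_univ f))

/-- **INFIMUM DESCENT (general form)**: for a per-tuple property `P` (`0 < N_f`) and a property `G` of offsets with
(OPENNESS) `P` above `μ` ∧ `G μ` ⇒ `P` above `μ − δ`, and (FINITENESS) `P` everywhere ⇒ `¬ G μ` somewhere: if `P` holds
above some `M₁` then some offset has `P` above it and `¬ G`.  Either the up-set is all of `ℝ` (finiteness) or its infimum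
is attained and openness would push `inf − δ` into it.
(Local copy of `InfimumDescent.exists_threshold_not_gapProp`, p134498.) [folklore] -/
theorem exists_threshold_not_gapProp (hNf : 0 < Nf) (P : (Fin Nf → ℝ) → Prop) (G : ℝ → Prop)
    (hopen : ∀ μ : ℝ, (∀ m : Fin Nf → ℝ, (∀ f, μ < m f) → P m) → G μ →
      ∃ δ > (0 : ℝ), ∀ m : Fin Nf → ℝ, (∀ f, μ - δ < m f) → P m)
    (hfin : (∀ m, P m) → ∃ μ : ℝ, ¬ G μ)
    {M₁ : ℝ} (hM : ∀ m : Fin Nf → ℝ, (∀ f, M₁ < m f) → P m) :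
    ∃ μ : ℝ, (∀ m : Fin Nf → ℝ, (∀ f, μ < m f) → P m) ∧ ¬ G μ := by
  classical
  set S : Set ℝ := {μ : ℝ | ∀ m : Fin Nf → ℝ, (∀ f, μ < m f) → P m} with hS
  have hne : S.Nonempty := ⟨M₁, hM⟩
  by_cases hbdd : BddBelow S
  · have hinf : sInf S ∈ S := forall_above_csInf hNf P hne hbdd
    refine ⟨sInf S, hinf, fun hG => ?_⟩
    obtain ⟨δ, hδ, hB'⟩ := hopen _ hinf hG
    have hle : sInf S ≤ sInf S - δ := csInf_le hbdd hB'
    linarith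
  · have hall : ∀ μ, μ ∈ S := by
      intro μ
      rw [bddBelow_def] at hbdd
      push Not at hbdd
      obtain ⟨y, hyS, hy⟩ := hbdd μ
      exact fun m hm => hyS m fun f => lt_of_le_of_lt hy.le (hm f)
    obtain ⟨μ, hμ⟩ := hfin fun m => hall _ m (neg_sum_abs_sub_one_lt m)
    exact ⟨μ, hall μ, hμ⟩

/-- The `m_crit`-shift by `μ` runs at masses `m` the scheme of `reg` at `μ + m` (tree vocabulary; cf. the landed
`Disproof.shift_scheme` / `scheme_mcrit_shift`). [folklore] -/
theorem scheme_mcrit_shift (reg : QCDRegularisation Nf) (μ : ℝ) (m : Fin Nf → ℝ)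
    (z shift : QCDField Nf → ℕ → ℝ) :
    ({ reg with mcrit := fun k => reg.mcrit k + reg.a k * μ / reg.Zm k } : QCDRegularisation Nf).scheme m z shift
      = reg.scheme (fun f => μ + m f) z shift := by
  simp only [QCDRegularisation.scheme, QCDScheme.mk.injEq, true_and, and_true]
  funext f k
  ring

/-- **The shifted witness**: body above `μ` along `reg` + NO uniform lattice rate just above `μ` ⇒ the `m_crit`-shift
of `reg` by `μ` witnesses `QCDOf N_f` (mass scaling never reads `m_crit`; chirality of the shift is the failure of every
rate just above `μ`; the body is transported along `scheme_mcrit_shift`).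
(Local copy of `InfimumDescent.qcdOf_of_bodyAbove_of_noUniformGapAbove`, p134498.) [folklore] -/
theorem qcdOf_of_bodyAbove_of_noUniformGapAbove (reg : QCDRegularisation Nf) (hMS : reg.HasMassScaling) (μ : ℝ)
    (hB : ∀ m : Fin Nf → ℝ, (∀ f, μ < m f) →
      ∃ (z shift : QCDField Nf → ℕ → ℝ) (T : OSData (QCDField Nf) 4),
        IsQCDAlong (reg.scheme m z shift) T ∧ T.IsNontrivial QCDField.glue ∧ T.IsNonGaussian QCDField.glue ∧
          (∀ f g : Fin Nf, f ≠ g → T.IsNontrivial (QCDField.pseudoRe f g)) ∧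
            ∃ Δ > 0, T.HasMassGap Δ ∧ (reg.scheme m z shift).HasLatticeMassGap Δ)
    (hG : ∀ ε > (0 : ℝ), ∃ m : Fin Nf → ℝ, (∀ f, μ < m f) ∧ ¬ (reg.scheme m 0 0).HasLatticeMassGap ε) :
    QCDOf Nf := by
  refine ⟨{ reg with mcrit := fun k => reg.mcrit k + reg.a k * μ / reg.Zm k }, hMS, ?_, ?_⟩
  · intro ε hε
    obtain ⟨m, hm, hng⟩ := hG ε hε
    refine ⟨fun f => m f - μ, fun f => sub_pos.mpr (hm f), ?_⟩
    have heq : (fun f => μ + (m f - μ)) = m := funext fun f => by ring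
    rw [scheme_mcrit_shift, heq]
    exact hng
  · intro m hm
    obtain ⟨z, shift, T, hT⟩ := hB (fun f => μ + m f) (fun f => lt_add_of_pos_right μ (hm f))
    exact ⟨z, shift, T, by rw [scheme_mcrit_shift]; exact hT⟩

/-- **`QCDOf N_f` from a threshold, OPENNESS and FINITE CHIRAL POINT (per flavour number)**, witnessed by the shift of
`reg` to the offset produced by the infimum descent.
(Local copy of `InfimumDescent.qcdOf_of_threshold_of_openness_of_finiteChiralPoint`, p134498.) [folklore] -/
theorem qcdOf_of_threshold_of_openness_of_finiteChiralPoint (hNf : 0 < Nf) (reg : QCDRegularisation Nf)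
    (hMS : reg.HasMassScaling)
    (h1 : ∀ μ : ℝ,
      (∀ m : Fin Nf → ℝ, (∀ f, μ < m f) →
        ∃ (z shift : QCDField Nf → ℕ → ℝ) (T : OSData (QCDField Nf) 4),
          IsQCDAlong (reg.scheme m z shift) T ∧ T.IsNontrivial QCDField.glue ∧ T.IsNonGaussian QCDField.glue ∧
            (∀ f g : Fin Nf, f ≠ g → T.IsNontrivial (QCDField.pseudoRe f g)) ∧
              ∃ Δ > 0, T.HasMassGap Δ ∧ (reg.scheme m z shift).HasLatticeMassGap Δ) →
      (∃ ε > (0 : ℝ), ∀ m : Fin Nf → ℝ, (∀ f, μ < m f) → (reg.scheme m 0 0).HasLatticeMassGap ε) →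
      ∃ δ > (0 : ℝ), ∀ m : Fin Nf → ℝ, (∀ f, μ - δ < m f) →
        ∃ (z shift : QCDField Nf → ℕ → ℝ) (T : OSData (QCDField Nf) 4),
          IsQCDAlong (reg.scheme m z shift) T ∧ T.IsNontrivial QCDField.glue ∧ T.IsNonGaussian QCDField.glue ∧
            (∀ f g : Fin Nf, f ≠ g → T.IsNontrivial (QCDField.pseudoRe f g)) ∧
              ∃ Δ > 0, T.HasMassGap Δ ∧ (reg.scheme m z shift).HasLatticeMassGap Δ)
    (h2 : (∀ m : Fin Nf → ℝ,
        ∃ (z shift : QCDField Nf → ℕ → ℝ) (T : OSData (QCDField Nf) 4),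
          IsQCDAlong (reg.scheme m z shift) T ∧ T.IsNontrivial QCDField.glue ∧ T.IsNonGaussian QCDField.glue ∧
            (∀ f g : Fin Nf, f ≠ g → T.IsNontrivial (QCDField.pseudoRe f g)) ∧
              ∃ Δ > 0, T.HasMassGap Δ ∧ (reg.scheme m z shift).HasLatticeMassGap Δ) →
        ∃ μ : ℝ, ∀ ε > (0 : ℝ), ∃ m : Fin Nf → ℝ, (∀ f, μ < m f) ∧ ¬ (reg.scheme m 0 0).HasLatticeMassGap ε)
    {M₁ : ℝ}
    (hbody : ∀ m : Fin Nf → ℝ, (∀ f, M₁ < m f) →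
      ∃ (z shift : QCDField Nf → ℕ → ℝ) (T : OSData (QCDField Nf) 4),
        IsQCDAlong (reg.scheme m z shift) T ∧ T.IsNontrivial QCDField.glue ∧ T.IsNonGaussian QCDField.glue ∧
          (∀ f g : Fin Nf, f ≠ g → T.IsNontrivial (QCDField.pseudoRe f g)) ∧
            ∃ Δ > 0, T.HasMassGap Δ ∧ (reg.scheme m z shift).HasLatticeMassGap Δ) :
    QCDOf Nf := by
  obtain ⟨μ, hB, hG⟩ := exists_threshold_not_gapProp hNf
    (fun m => ∃ (z shift : QCDField Nf → ℕ → ℝ) (T : OSData (QCDField Nf) 4),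
      IsQCDAlong (reg.scheme m z shift) T ∧ T.IsNontrivial QCDField.glue ∧ T.IsNonGaussian QCDField.glue ∧
        (∀ f g : Fin Nf, f ≠ g → T.IsNontrivial (QCDField.pseudoRe f g)) ∧
          ∃ Δ > 0, T.HasMassGap Δ ∧ (reg.scheme m z shift).HasLatticeMassGap Δ)
    (fun μ => ∃ ε > (0 : ℝ), ∀ m : Fin Nf → ℝ, (∀ f, μ < m f) → (reg.scheme m 0 0).HasLatticeMassGap ε)
    h1
    (fun hall => by
      obtain ⟨μ, hμ⟩ := h2 hall
      refine ⟨μ, ?_⟩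
      rintro ⟨ε, hε, hgap⟩
      obtain ⟨m, hm, hng⟩ := hμ ε hε
      exact hng (hgap m hm))
    hbody
  refine qcdOf_of_bodyAbove_of_noUniformGapAbove reg hMS μ hB fun ε hε => ?_
  by_contra hcon
  push Not at hcon
  exact hG ⟨ε, hε, fun m hm => hcon m hm⟩

end Glue

open Glue

/-- **The sibling crux implies this crux** (kernel-checked `example`, 17527 ⇒ 17578). The hypothesis is literally `SpectralDefectExtinction.ChiralDescent`
(stmt-17527) UNFOLDED — per flavour number, `Threshold N_f → QCDOf N_f` — so a proof term of that decl can be passed here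
by `δ`-unfolding; it gives `WilsonQuarkChessboard.ChiralDescent` (stmt-17578: both thresholds ⇒ `QCD`) by instantiating at
`N_f = 2, 3` and reordering `∃ M₀, ∃ reg` into `∃ reg, ∃ M₁`.  (Stated unfolded so that this file imports no second route
file.) [folklore] -/
example
    (h : ∀ Nf : ℕ, (Nf = 2 ∨ Nf = 3) →
      (∃ reg : QCDRegularisation Nf, reg.HasMassScaling ∧ ∃ M₁ : ℝ, 0 ≤ M₁ ∧ ∀ m : Fin Nf → ℝ, (∀ f, M₁ < m f) →
        ∃ (z shift : QCDField Nf → ℕ → ℝ) (T : OSData (QCDField Nf) 4),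
          IsQCDAlong (reg.scheme m z shift) T ∧ T.IsNontrivial QCDField.glue ∧ T.IsNonGaussian QCDField.glue ∧
            (∀ f g : Fin Nf, f ≠ g → T.IsNontrivial (QCDField.pseudoRe f g)) ∧
              ∃ Δ > 0, T.HasMassGap Δ ∧ (reg.scheme m z shift).HasLatticeMassGap Δ) → QCDOf Nf) :
    Summit.QuantumFields.QCD.Theses.WilsonQuarkChessboard.ChiralDescent := by
  intro hT
  have key : ∀ Nf : ℕ, (Nf = 2 ∨ Nf = 3) → QCDOf Nf := by
    intro Nf hNf
    obtain ⟨M₀, hM₀, reg, hMS, hB⟩ := hT Nf hNf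
    exact h Nf hNf ⟨reg, hMS, M₀, hM₀, hB⟩
  exact ⟨key 2 (Or.inl rfl), key 3 (Or.inr rfl)⟩

/-! ## §3 The crux by name -/

/-- **The composition, hypotheses form (sorry-free): stub 1 → stub 2 → the crux UNFOLDED** (`(∀ N_f ∈ {2,3}, threshold
data) → QCD`; stated unfolded so that `ChiralDescent_of` below is the ONLY theorem whose conclusion is literally the crux
decl — the skeleton registry keys on that).  Per flavour number `N_f ∈ {2,3}`: unpack the threshold data
`⟨M₀, -, reg, hMS, body above M₀⟩`, feed openness and the finite chiral point for that `reg` to the infimum descent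
`Glue.qcdOf_of_threshold_of_openness_of_finiteChiralPoint` (the shift of `reg` by the produced offset witnesses `QCDOf N_f`),
then assemble `QCD = QCDOf 2 ∧ QCDOf 3`. [folklore] -/
theorem qcd_of_lightQuarkContinuation_of_chiralPoint
    (h1 : ∀ Nf : ℕ, (Nf = 2 ∨ Nf = 3) → ∀ reg : QCDRegularisation Nf, reg.HasMassScaling → ∀ μ : ℝ,
      (∀ m : Fin Nf → ℝ, (∀ f, μ < m f) →
        ∃ (z shift : QCDField Nf → ℕ → ℝ) (T : OSData (QCDField Nf) 4),
          IsQCDAlong (reg.scheme m z shift) T ∧ T.IsNontrivial QCDField.glue ∧ T.IsNonGaussian QCDField.glue ∧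
            (∀ f g : Fin Nf, f ≠ g → T.IsNontrivial (QCDField.pseudoRe f g)) ∧
              ∃ Δ > 0, T.HasMassGap Δ ∧ (reg.scheme m z shift).HasLatticeMassGap Δ) →
      (∃ ε > (0 : ℝ), ∀ m : Fin Nf → ℝ, (∀ f, μ < m f) → (reg.scheme m 0 0).HasLatticeMassGap ε) →
      ∃ δ > (0 : ℝ), ∀ m : Fin Nf → ℝ, (∀ f, μ - δ < m f) →
        ∃ (z shift : QCDField Nf → ℕ → ℝ) (T : OSData (QCDField Nf) 4),
          IsQCDAlong (reg.scheme m z shift) T ∧ T.IsNontrivial QCDField.glue ∧ T.IsNonGaussian QCDField.glue ∧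
            (∀ f g : Fin Nf, f ≠ g → T.IsNontrivial (QCDField.pseudoRe f g)) ∧
              ∃ Δ > 0, T.HasMassGap Δ ∧ (reg.scheme m z shift).HasLatticeMassGap Δ)
    (h2 : ∀ Nf : ℕ, (Nf = 2 ∨ Nf = 3) → ∀ reg : QCDRegularisation Nf, reg.HasMassScaling →
      (∀ m : Fin Nf → ℝ,
        ∃ (z shift : QCDField Nf → ℕ → ℝ) (T : OSData (QCDField Nf) 4),
          IsQCDAlong (reg.scheme m z shift) T ∧ T.IsNontrivial QCDField.glue ∧ T.IsNonGaussian QCDField.glue ∧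
            (∀ f g : Fin Nf, f ≠ g → T.IsNontrivial (QCDField.pseudoRe f g)) ∧
              ∃ Δ > 0, T.HasMassGap Δ ∧ (reg.scheme m z shift).HasLatticeMassGap Δ) →
      ∃ μ : ℝ, ∀ ε > (0 : ℝ), ∃ m : Fin Nf → ℝ, (∀ f, μ < m f) ∧ ¬ (reg.scheme m 0 0).HasLatticeMassGap ε)
    (hT : ∀ Nf : ℕ, Nf = 2 ∨ Nf = 3 → ∃ M₀ : ℝ, 0 ≤ M₀ ∧ ∃ reg : QCDRegularisation Nf, reg.HasMassScaling ∧
      ∀ m : Fin Nf → ℝ, (∀ f, M₀ < m f) →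
        ∃ (z shift : QCDField Nf → ℕ → ℝ) (T : OSData (QCDField Nf) 4),
          IsQCDAlong (reg.scheme m z shift) T ∧ T.IsNontrivial QCDField.glue ∧ T.IsNonGaussian QCDField.glue ∧
            (∀ f g : Fin Nf, f ≠ g → T.IsNontrivial (QCDField.pseudoRe f g)) ∧
              ∃ Δ > 0, T.HasMassGap Δ ∧ (reg.scheme m z shift).HasLatticeMassGap Δ) :
    QCD := by
  have key : ∀ Nf : ℕ, (Nf = 2 ∨ Nf = 3) → QCDOf Nf := by
    intro Nf hNf
    obtain ⟨M₀, -, reg, hMS, hbody⟩ := hT Nf hNf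
    exact qcdOf_of_threshold_of_openness_of_finiteChiralPoint (nf_pos hNf) reg hMS (h1 Nf hNf reg hMS)
      (h2 Nf hNf reg hMS) hbody
  exact ⟨key 2 (Or.inl rfl), key 3 (Or.inr rfl)⟩

/-- **The crux BY NAME, modulo exactly the two registered stubs** (registry form: conclusion literally
`Summit.QuantumFields.QCD.Theses.WilsonQuarkChessboard.ChiralDescent`, the stubs entering by name; the crux unfolds by `δ`
to the conclusion of `qcd_of_lightQuarkContinuation_of_chiralPoint`).  Its only non-standard axiom is the `sorryAx` of
the two stubs. [folklore] -/
theorem ChiralDescent_of : Summit.QuantumFields.QCD.Theses.WilsonQuarkChessboard.ChiralDescent :=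
  qcd_of_lightQuarkContinuation_of_chiralPoint stub_lightQuarkContinuation stub_chiralPointOfBodyEverywhere

/-- The hypotheses form with the conclusion folded back BY NAME (kernel-checked `example`: `stub₁-sig → stub₂-sig →
ChiralDescent`, sorry-free — the BC3 letter). [folklore] -/
example :
    (∀ Nf : ℕ, (Nf = 2 ∨ Nf = 3) → ∀ reg : QCDRegularisation Nf, reg.HasMassScaling → ∀ μ : ℝ,
      (∀ m : Fin Nf → ℝ, (∀ f, μ < m f) →
        ∃ (z shift : QCDField Nf → ℕ → ℝ) (T : OSData (QCDField Nf) 4),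
          IsQCDAlong (reg.scheme m z shift) T ∧ T.IsNontrivial QCDField.glue ∧ T.IsNonGaussian QCDField.glue ∧
            (∀ f g : Fin Nf, f ≠ g → T.IsNontrivial (QCDField.pseudoRe f g)) ∧
              ∃ Δ > 0, T.HasMassGap Δ ∧ (reg.scheme m z shift).HasLatticeMassGap Δ) →
      (∃ ε > (0 : ℝ), ∀ m : Fin Nf → ℝ, (∀ f, μ < m f) → (reg.scheme m 0 0).HasLatticeMassGap ε) →
      ∃ δ > (0 : ℝ), ∀ m : Fin Nf → ℝ, (∀ f, μ - δ < m f) →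
        ∃ (z shift : QCDField Nf → ℕ → ℝ) (T : OSData (QCDField Nf) 4),
          IsQCDAlong (reg.scheme m z shift) T ∧ T.IsNontrivial QCDField.glue ∧ T.IsNonGaussian QCDField.glue ∧
            (∀ f g : Fin Nf, f ≠ g → T.IsNontrivial (QCDField.pseudoRe f g)) ∧
              ∃ Δ > 0, T.HasMassGap Δ ∧ (reg.scheme m z shift).HasLatticeMassGap Δ) →
    (∀ Nf : ℕ, (Nf = 2 ∨ Nf = 3) → ∀ reg : QCDRegularisation Nf, reg.HasMassScaling →
      (∀ m : Fin Nf → ℝ,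
        ∃ (z shift : QCDField Nf → ℕ → ℝ) (T : OSData (QCDField Nf) 4),
          IsQCDAlong (reg.scheme m z shift) T ∧ T.IsNontrivial QCDField.glue ∧ T.IsNonGaussian QCDField.glue ∧
            (∀ f g : Fin Nf, f ≠ g → T.IsNontrivial (QCDField.pseudoRe f g)) ∧
              ∃ Δ > 0, T.HasMassGap Δ ∧ (reg.scheme m z shift).HasLatticeMassGap Δ) →
      ∃ μ : ℝ, ∀ ε > (0 : ℝ), ∃ m : Fin Nf → ℝ, (∀ f, μ < m f) ∧ ¬ (reg.scheme m 0 0).HasLatticeMassGap ε) →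
    Summit.QuantumFields.QCD.Theses.WilsonQuarkChessboard.ChiralDescent :=
  fun h1 h2 => qcd_of_lightQuarkContinuation_of_chiralPoint h1 h2

/-! ## §4 For the record: this crux from the sibling's current single stub E -/

/-- **This crux from E** (kernel-checked `example`; "every mass-scaling regularisation with a threshold carries the body above an offset at which
it has no uniform lattice rate", the sibling skeleton's cycle-4 stub `stub_chiralPointOfThreshold`): the shift of `reg`
by the E-offset is the witness (`qcdOf_of_bodyAbove_of_noUniformGapAbove`, p134498; same proof as the sibling's landed
one-line closer `chiralDescent_of_chiralPointOfThreshold`, p137636, whose module is not imported here).  By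
`chiralPoint_iff_stubs` (p137636) E for a regularisation with a threshold is exactly (stub 1 ∧ stub 2) for it, read
through `openness ⇔ gapless infimum`. [folklore] -/
example
    (hE : ∀ Nf : ℕ, (Nf = 2 ∨ Nf = 3) → ∀ reg : QCDRegularisation Nf, reg.HasMassScaling → ∀ M₁ : ℝ,
      (∀ m : Fin Nf → ℝ, (∀ f, M₁ < m f) →
        ∃ (z shift : QCDField Nf → ℕ → ℝ) (T : OSData (QCDField Nf) 4),
          IsQCDAlong (reg.scheme m z shift) T ∧ T.IsNontrivial QCDField.glue ∧ T.IsNonGaussian QCDField.glue ∧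
            (∀ f g : Fin Nf, f ≠ g → T.IsNontrivial (QCDField.pseudoRe f g)) ∧
              ∃ Δ > 0, T.HasMassGap Δ ∧ (reg.scheme m z shift).HasLatticeMassGap Δ) →
      ∃ μ : ℝ, (∀ m : Fin Nf → ℝ, (∀ f, μ < m f) →
        ∃ (z shift : QCDField Nf → ℕ → ℝ) (T : OSData (QCDField Nf) 4),
          IsQCDAlong (reg.scheme m z shift) T ∧ T.IsNontrivial QCDField.glue ∧ T.IsNonGaussian QCDField.glue ∧
            (∀ f g : Fin Nf, f ≠ g → T.IsNontrivial (QCDField.pseudoRe f g)) ∧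
              ∃ Δ > 0, T.HasMassGap Δ ∧ (reg.scheme m z shift).HasLatticeMassGap Δ) ∧
        ∀ ε > (0 : ℝ), ∃ m : Fin Nf → ℝ, (∀ f, μ < m f) ∧ ¬ (reg.scheme m 0 0).HasLatticeMassGap ε) :
    Summit.QuantumFields.QCD.Theses.WilsonQuarkChessboard.ChiralDescent := by
  intro hT
  have key : ∀ Nf : ℕ, (Nf = 2 ∨ Nf = 3) → QCDOf Nf := by
    intro Nf hNf
    obtain ⟨M₀, -, reg, hMS, hbody⟩ := hT Nf hNf
    obtain ⟨μ, hB, hG⟩ := hE Nf hNf reg hMS M₀ hbody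
    exact qcdOf_of_bodyAbove_of_noUniformGapAbove reg hMS μ hB hG
  exact ⟨key 2 (Or.inl rfl), key 3 (Or.inr rfl)⟩

end Summit.QuantumFields.QCD.Cruxes.ChiralDescent.Birth
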